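import Summits.Ventures.HSemireg.Pad4TowerSeedB1Odd
import Summits.Ventures.HSemireg.Pad4TowerRuleDMu4Dual

/-!
# Sketch (anomaly g8, folder-only): the CHARGE-COUNT LADDER split of `LineConfinement h`
`chargedCount` ∕ `ThinCell` ∕ `SingleLine` ∕ `LineConfinement` restated byte-for-byte from `Cruxes/BlochSeedDiscOne/ThinnessTarget.lean` §1∕§6.
Grade a cell by its number of charged letters (0–4; `ThinCell` = grade ≤ 1). CORE = grade-2 cells («2+2 cells»: two apex letters, two charged);
BULK₃ ∕ BULK₄ = grades 3 ∕ 4 fall once the lower grades are single-line. Proved here for NO `h` except the glue. Machine status (FULL ◇₄ and FULL ◇₆,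
hub ×1, my UP engine): every grade-3 (resp. grade-4) multi-line cell literal is falsified INSIDE the unit-propagation closure of ¬(grade-2 multi-line
cells) (resp. ¬(grades 2,3)) — 476∕476 + 504∕504 at ◇₄, 4 948∕4 948 + 7 932∕7 932 at ◇₆; the grade-2 core is NOT UP-closed from itself at ◇₆ (residual 110).
Census-neutral; nothing here says HC ∕ HC_CM ∕ HC_AV ∕ H2 ∕ 18881 holds or fails. No sorry, no axiom, no instance, no notation.
-/

namespace Summit.Ventures.HSemireg.Pad4Tower
namespace AnomalyLens
namespace ChargeLadderSketch

open Finset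

abbrev chargedCount (Z : MCell) : ℕ := (univ.filter fun f : Fin 4 => (Z f).2 ≠ (0, 0)).card
abbrev ThinCell (Z : MCell) : Prop := chargedCount Z ≤ 1
abbrev SingleLine (Z : MCell) : Prop := ∀ f, (Z f).1 + absCharge (Z f) = (Z 0).1 + absCharge (Z 0)

def LineConfinement (h : ℤ) : Prop :=
  ∀ C : MConfig, C.InDiamond h → C.G1Closed → C.StaticH1 →
    (∀ Z ∈ C.lower, ¬ ThinCell Z → SingleLine Z) ∧ ∀ P ∈ C.upper, ¬ ThinCell P → SingleLine P

/-- all cells (both levels) of the support with exactly `k` charged letters are single-line. -/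
abbrev GradeConfined (k : ℕ) (C : MConfig) : Prop :=
  (∀ Z ∈ C.lower, chargedCount Z = k → SingleLine Z) ∧ ∀ P ∈ C.upper, chargedCount P = k → SingleLine P

/-- **CORE** (grade 2, «2+2 cells»; proved for NO `h`): in a `◇_h`-supported `G₁`-closed `H₁`-static support every cell with exactly two charged
letters is single-line. Machine: 226 (◇₄) ∕ 1 492 (◇₆) multi-line grade-2 orbits, all refuted (part of L1 UNSAT); pure-UP internal layering
[15,94,50,43,22,2] residual 0 at ◇₄ but residual 110 at ◇₆ — the core is where the height-dependence lives. -/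
def PairCellConfinement (h : ℤ) : Prop :=
  ∀ C : MConfig, C.InDiamond h → C.G1Closed → C.StaticH1 → GradeConfined 2 C

/-- **BULK₃** (proved for NO `h`): grade-2 confinement of a static support forces grade-3 confinement. Machine ◇₄∕◇₆: UP-closed (derivation depth ≤ 3 ∕ ≤ 5,
cone clause-steps median 1 ∕ 3, max 4 ∕ 16). -/
def Bulk3 (h : ℤ) : Prop :=
  ∀ C : MConfig, C.InDiamond h → C.G1Closed → C.StaticH1 → GradeConfined 2 C → GradeConfined 3 C

/-- **BULK₄** (proved for NO `h`): grade-2 and grade-3 confinement force confinement of the fully charged cells. Machine ◇₄∕◇₆: UP-closed (depth ≤ 4 ∕ ≤ 6,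
cone clause-steps median 2 ∕ 5, max 7 ∕ 32). -/
def Bulk4 (h : ℤ) : Prop :=
  ∀ C : MConfig, C.InDiamond h → C.G1Closed → C.StaticH1 → GradeConfined 2 C → GradeConfined 3 C → GradeConfined 4 C

theorem chargedCount_le_four (Z : MCell) : chargedCount Z ≤ 4 :=
  (card_filter_le _ _).trans (by simp)

/-- a cell that is not thin has grade 2, 3 or 4. -/
theorem grade_of_not_thin (Z : MCell) (hZ : ¬ ThinCell Z) : chargedCount Z = 2 ∨ chargedCount Z = 3 ∨ chargedCount Z = 4 := by
  have h4 := chargedCount_le_four Z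
  unfold ThinCell at hZ
  omega

/-- glue: CORE ∧ BULK₃ ∧ BULK₄ ⇒ `LineConfinement h`. Logic plus `chargedCount ≤ 4`. -/
theorem lineConfinement_of_chargeLadder (h : ℤ) (H2 : PairCellConfinement h) (H3 : Bulk3 h) (H4 : Bulk4 h) : LineConfinement h := by
  intro C hD hG hSt
  have g2 := H2 C hD hG hSt
  have g3 := H3 C hD hG hSt g2
  have g4 := H4 C hD hG hSt g2 g3
  refine ⟨fun Z hZ hth => ?_, fun P hP hth => ?_⟩
  · rcases grade_of_not_thin Z hth with e | e | e
    · exact g2.1 Z hZ e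
    · exact g3.1 Z hZ e
    · exact g4.1 Z hZ e
  · rcases grade_of_not_thin P hth with e | e | e
    · exact g2.2 P hP e
    · exact g3.2 P hP e
    · exact g4.2 P hP e

/-- conversely the three pieces are consequences of `LineConfinement h` (a grade-≥2 cell is not thin) — the split loses nothing. -/
theorem core_of_lineConfinement (h : ℤ) (H : LineConfinement h) : PairCellConfinement h := by
  intro C hD hG hSt
  refine ⟨fun Z hZ e => (H C hD hG hSt).1 Z hZ ?_, fun P hP e => (H C hD hG hSt).2 P hP ?_⟩ <;>
    · unfold ThinCell; omega

theorem bulk3_of_lineConfinement (h : ℤ) (H : LineConfinement h) : Bulk3 h := by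
  intro C hD hG hSt _
  refine ⟨fun Z hZ e => (H C hD hG hSt).1 Z hZ ?_, fun P hP e => (H C hD hG hSt).2 P hP ?_⟩ <;>
    · unfold ThinCell; omega

theorem bulk4_of_lineConfinement (h : ℤ) (H : LineConfinement h) : Bulk4 h := by
  intro C hD hG hSt _ _
  refine ⟨fun Z hZ e => (H C hD hG hSt).1 Z hZ ?_, fun P hP e => (H C hD hG hSt).2 P hP ?_⟩ <;>
    · unfold ThinCell; omega

/-- **BULK by RULE D ALONE** (proved for NO `h`; machine-exact at FULL ◇₄ and FULL ◇₆, DN+DP clauses only: 16 010 ∕ 236 642 clauses; from ¬grade-2,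
grade 3 then grade 4 fall by unit propagation, 0 failures): rule-D closure of a `◇_h`-supported `G₁`-closed support whose 2+2 cells are single-line already
confines its 3- and 4-charged cells — no X⁺, no A2I⁻. -/
def BulkRD (h : ℤ) : Prop :=
  ∀ C : MConfig, C.InDiamond h → C.G1Closed → RuleDMu4Closed C → GradeConfined 2 C → GradeConfined 3 C ∧ GradeConfined 4 C

theorem bulk3_of_bulkRD (h : ℤ) (H : BulkRD h) : Bulk3 h :=
  fun C hD hG hSt g2 => (H C hD hG hSt.1 g2).1

theorem bulk4_of_bulkRD (h : ℤ) (H : BulkRD h) : Bulk4 h :=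
  fun C hD hG hSt g2 _ => (H C hD hG hSt.1 g2).2

/-- glue, rule-D form: CORE ∧ BULK-by-rule-D ⇒ `LineConfinement h`. -/
theorem lineConfinement_of_core_bulkRD (h : ℤ) (H2 : PairCellConfinement h) (HB : BulkRD h) : LineConfinement h :=
  lineConfinement_of_chargeLadder h H2 (bulk3_of_bulkRD h HB) (bulk4_of_bulkRD h HB)

/-! ## §7 The floor ∕ ceiling filtration of the BULK (measured 2026-08-29, FULL ◇₄ ∕ ◇₆ ∕ ◇₈, rule-D clauses only)

MACHINE FACTS behind this section (plan-lens-HodgeAV-anomaly g8, `lens/rank/order3.py`, `baseup.py`; ×1): (a) the plain unit-propagation closure of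
«every multi-line 2+2 cell absent (both levels)» under the DN+DP clauses refutes EVERY multi-line cell with ≥ 3 charged letters — 980 ∕ 980 (◇₄),
12 880 ∕ 12 880 (◇₆), 87 012 ∕ 87 012 (◇₈) literals, no probing, no case split; (b) DECOUPLED FILTRATION: order the lower (N) cells by the least node
level `t = α − c` of a charged letter, `d ∈ {0, 2, 4, 6}`; with premises «2+2 multi-line cells absent» ∪ «lower ≥3-charged multi-line cells of smaller d
absent» and NO premise on upper ≥3-charged cells, plain UP refutes every lower cell of level `d`: ◇₈ levels (d : cells) = (0 : 36 416), (2 : 6 418),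
(4 : 652), (6 : 20), 0 failures; ◇₆ (0 : 5 859), (2 : 566), (4 : 15); ◇₄ (0 : 480), (2 : 10); the upper (P) cells dually by the least ceiling distance
`h − (α + c)` of a charged letter, same counts, 0 failures (measured directly — the DN+DP clause set is exactly ι-invariant but the multi-line goal set is
not, ι maps lines to node levels). So `BulkRD h` should follow from the two STEP statements below by the induction `bulkRD_of_steps` (proved here);
the steps are proved for NO `h` and NO `d`. -/

/-- node level (apex index, «co-line») `t = α − c` of a letter; `OnFloor x ↔ nodeLevel x = 0`. -/
abbrev nodeLevel (x : BPoint) : ℤ := x.1 - absCharge x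

/-- causal height («line») `α + c` of a letter; `OnCeiling h x ↔ lineOf x = h`. -/
abbrev lineOf (x : BPoint) : ℤ := x.1 + absCharge x

/-- every LOWER cell with ≥ 3 charged letters one of which has node level `< d` is single-line. -/
abbrev LowerBulkBelow (d : ℤ) (C : MConfig) : Prop :=
  ∀ Z ∈ C.lower, 3 ≤ chargedCount Z → (∃ f, (Z f).2 ≠ (0, 0) ∧ nodeLevel (Z f) < d) → SingleLine Z

/-- every UPPER cell with ≥ 3 charged letters one of which has ceiling distance `h − (α + c) < d` is single-line. -/
abbrev UpperBulkAbove (h d : ℤ) (C : MConfig) : Prop :=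
  ∀ P ∈ C.upper, 3 ≤ chargedCount P → (∃ f, (P f).2 ≠ (0, 0) ∧ h - lineOf (P f) < d) → SingleLine P

/-- **N-STEP at floor distance `d`** (proved for NO `h`, `d`; machine: plain UP, 0 failures at FULL ◇₄∕◇₆∕◇₈): in a `◇_h`-supported `G₁`-closed
rule-D-closed support whose 2+2 cells are single-line, if all lower ≥3-charged cells reaching below node level `d` are single-line then so are those
reaching below `d + 1`. (Only even `d` carry content: node levels are even in `◇_h`.) -/
def BulkStepN (h d : ℤ) : Prop :=
  ∀ C : MConfig, C.InDiamond h → C.G1Closed → RuleDMu4Closed C → GradeConfined 2 C → LowerBulkBelow d C → LowerBulkBelow (d + 1) C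

/-- **P-STEP at ceiling distance `d`** (proved for NO `h`, `d`; machine as for the N-step, measured directly). -/
def BulkStepP (h d : ℤ) : Prop :=
  ∀ C : MConfig, C.InDiamond h → C.G1Closed → RuleDMu4Closed C → GradeConfined 2 C → UpperBulkAbove h d C → UpperBulkAbove h (d + 1) C

theorem lowerBulkBelow_zero {h : ℤ} {C : MConfig} (hD : C.InDiamond h) : LowerBulkBelow 0 C := by
  rintro Z hZ - ⟨f, -, hlt⟩
  have hx := (hD.1 Z hZ f).2.1
  simp only [nodeLevel] at hlt
  omega

theorem upperBulkAbove_zero {h : ℤ} {C : MConfig} (hD : C.InDiamond h) : UpperBulkAbove h 0 C := by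
  rintro P hP - ⟨f, -, hlt⟩
  have hx := (hD.2 P hP f).2.2.2
  simp only [lineOf] at hlt
  omega

theorem exists_charged_of_three_le {Z : MCell} (h3 : 3 ≤ chargedCount Z) : ∃ f, (Z f).2 ≠ (0, 0) := by
  have hpos : 0 < (univ.filter fun f : Fin 4 => (Z f).2 ≠ (0, 0)).card := lt_of_lt_of_le (by norm_num) h3
  obtain ⟨f, hf⟩ := Finset.card_pos.mp hpos
  exact ⟨f, (Finset.mem_filter.mp hf).2⟩

/-- **the induction**: the N-steps and P-steps for all `d ≥ 0` give `BulkRD h` (node levels and ceiling distances of `◇_h` letters lie in `[0, h]`). -/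
theorem bulkRD_of_steps (h : ℤ) (HN : ∀ d : ℕ, BulkStepN h d) (HP : ∀ d : ℕ, BulkStepP h d) : BulkRD h := by
  intro C hD hG hR g2
  have LN : ∀ d : ℕ, LowerBulkBelow (d : ℤ) C := by
    intro d
    induction d with
    | zero => exact_mod_cast lowerBulkBelow_zero hD
    | succ n ih =>
      have := HN n C hD hG hR g2 ih
      simpa [Nat.cast_succ] using this
  have LP : ∀ d : ℕ, UpperBulkAbove h (d : ℤ) C := by
    intro d
    induction d with
    | zero => exact_mod_cast upperBulkAbove_zero hD
    | succ n ih =>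
      have := HP n C hD hG hR g2 ih
      simpa [Nat.cast_succ] using this
  have keyN : ∀ Z ∈ C.lower, 3 ≤ chargedCount Z → SingleLine Z := by
    intro Z hZ h3
    obtain ⟨f, hf⟩ := exists_charged_of_three_le h3
    have hx := hD.1 Z hZ f
    refine LN (h.toNat + 1) Z hZ h3 ⟨f, hf, ?_⟩
    have h1 := hx.2.1
    have h2 := hx.2.2.2
    have h3' : h ≤ (h.toNat : ℤ) := Int.self_le_toNat h
    simp only [nodeLevel, Nat.cast_add, Nat.cast_one]
    have : (0 : ℤ) ≤ absCharge (Z f) := abs_nonneg _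
    omega
  have keyP : ∀ P ∈ C.upper, 3 ≤ chargedCount P → SingleLine P := by
    intro P hP h3
    obtain ⟨f, hf⟩ := exists_charged_of_three_le h3
    have hx := hD.2 P hP f
    refine LP (h.toNat + 1) P hP h3 ⟨f, hf, ?_⟩
    have h1 := hx.2.1
    have h3' : h ≤ (h.toNat : ℤ) := Int.self_le_toNat h
    simp only [lineOf, Nat.cast_add, Nat.cast_one]
    have : (0 : ℤ) ≤ absCharge (P f) := abs_nonneg _
    omega
  exact ⟨⟨fun Z hZ e => keyN Z hZ (by omega), fun P hP e => keyP P hP (by omega)⟩,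
    ⟨fun Z hZ e => keyN Z hZ (by omega), fun P hP e => keyP P hP (by omega)⟩⟩

/-- conversely each step is a consequence of `BulkRD h` (so the filtration loses nothing). -/
theorem bulkStepN_of_bulkRD (h d : ℤ) (H : BulkRD h) : BulkStepN h d := by
  intro C hD hG hR g2 _ Z hZ h3 _
  have h4 := chargedCount_le_four Z
  rcases (show chargedCount Z = 3 ∨ chargedCount Z = 4 by omega) with e | e
  · exact (H C hD hG hR g2).1.1 Z hZ e
  · exact (H C hD hG hR g2).2.1 Z hZ e

theorem bulkStepP_of_bulkRD (h d : ℤ) (H : BulkRD h) : BulkStepP h d := by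
  intro C hD hG hR g2 _ P hP h3 _
  have h4 := chargedCount_le_four P
  rcases (show chargedCount P = 3 ∨ chargedCount P = 4 by omega) with e | e
  · exact (H C hD hG hR g2).1.2 P hP e
  · exact (H C hD hG hR g2).2.2 P hP e

/-! ## §8 The extremal all-floor family (v1.3, memo §9 (F7)) — the suggested FIRST all-`h` test lemma for the inner induction
At FULL ◇₈ the deepest plain-UP derivations (9 BFS rounds from the 2+2 base, DN+DP only) are exactly those of the 20 + 20 cells
`N∕P[2l_* | 3l_* | 3l_* | 3l_*]` — all four letters charged and ON THE FLOOR `α = |c|`, charges `(m, m+1, m+1, m+1)`, `m = h∕2 − 2`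
(◇₄: `N[l|2l|2l|2l]`, depth 4). `floorLetter c u = (c, c•u)` for an axis direction `u`; `extremalCell m u` is the cell; the lemma says the
rule-D closure of a `◇_h`-supported `G₁`-closed support with single-line 2-charged cells contains it on NEITHER level. Proved for NO `h`;
it is a COROLLARY of `BulkRD h` (`extremalFamilyDies_of_bulkRD`, h ≥ 6), filed as the cheapest all-`h` statement exercising the full-length
alternating chain of (F7). -/

/-- the four axis directions. -/
abbrev IsDir (u : ℤ × ℤ) : Prop := u = (1, 0) ∨ u = (-1, 0) ∨ u = (0, 1) ∨ u = (0, -1)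

/-- the floor letter of charge `|c|` in direction `u`: the point `(c, c·u₁, c·u₂)` (for `c ≥ 1` and `u` a direction: `α = c = absCharge`). -/
abbrev floorLetter (c : ℤ) (u : ℤ × ℤ) : BPoint := (c, c * u.1, c * u.2)

/-- the extremal all-floor cell `[m·l_{u 0} | (m+1)·l_{u 1} | (m+1)·l_{u 2} | (m+1)·l_{u 3}]`. -/
def extremalCell (m : ℤ) (u : Fin 4 → ℤ × ℤ) : MCell :=
  fun f => if f = 0 then floorLetter m (u 0) else floorLetter (m + 1) (u f)

/-- **(F7) test lemma** (proved for NO `h`): under the hypotheses of `BulkRD h`, the extremal all-floor cells with `m = h∕2 − 2` lie on neither level. -/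
def ExtremalFamilyDies (h : ℤ) : Prop :=
  ∀ C : MConfig, C.InDiamond h → C.G1Closed → RuleDMu4Closed C → GradeConfined 2 C →
    ∀ u : Fin 4 → ℤ × ℤ, (∀ f, IsDir (u f)) → extremalCell (h / 2 - 2) u ∉ C.lower ∧ extremalCell (h / 2 - 2) u ∉ C.upper

theorem absCharge_floorLetter (c : ℤ) {u : ℤ × ℤ} (hu : IsDir u) : absCharge (floorLetter c u) = |c| := by
  rcases hu with rfl | rfl | rfl | rfl <;> simp [absCharge, chargeOf]

theorem floorLetter_charged {c : ℤ} (hc : c ≠ 0) {u : ℤ × ℤ} (hu : IsDir u) : (floorLetter c u).2 ≠ (0, 0) := by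
  rcases hu with rfl | rfl | rfl | rfl <;> simp [hc]

theorem chargedCount_extremalCell {m : ℤ} (hm : 1 ≤ m) {u : Fin 4 → ℤ × ℤ} (hu : ∀ f, IsDir (u f)) :
    chargedCount (extremalCell m u) = 4 := by
  have hall : ∀ f : Fin 4, (extremalCell m u f).2 ≠ (0, 0) := by
    intro f
    by_cases hf : f = 0
    · subst hf; simpa [extremalCell] using floorLetter_charged (c := m) (by omega) (hu 0)
    · simpa [extremalCell, hf] using floorLetter_charged (c := m + 1) (by omega) (hu f)
  simp only [chargedCount]
  rw [Finset.filter_true_of_mem (fun f _ => hall f)]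
  simp

theorem not_singleLine_extremalCell {m : ℤ} (hm : 1 ≤ m) {u : Fin 4 → ℤ × ℤ} (hu : ∀ f, IsDir (u f)) :
    ¬ SingleLine (extremalCell m u) := by
  intro hS
  have h1 := hS 1
  have e0 : extremalCell m u 0 = floorLetter m (u 0) := by simp [extremalCell]
  have e1 : extremalCell m u 1 = floorLetter (m + 1) (u 1) := by simp [extremalCell]
  rw [e0, e1, absCharge_floorLetter m (hu 0), absCharge_floorLetter (m + 1) (hu 1)] at h1
  simp only at h1
  rw [abs_of_nonneg (by omega : (0 : ℤ) ≤ m), abs_of_nonneg (by omega : (0 : ℤ) ≤ m + 1)] at h1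
  omega

/-- the test lemma is a corollary of the BULK (for `h ≥ 6`, so that `m = h∕2 − 2 ≥ 1`). -/
theorem extremalFamilyDies_of_bulkRD {h : ℤ} (hh : 6 ≤ h) (H : BulkRD h) : ExtremalFamilyDies h := by
  intro C hD hG hR g2 u hu
  have hm : 1 ≤ h / 2 - 2 := by omega
  have h4 := chargedCount_extremalCell hm hu
  have hns := not_singleLine_extremalCell hm hu
  obtain ⟨-, g4⟩ := H C hD hG hR g2
  exact ⟨fun hZ => hns (g4.1 _ hZ h4), fun hP => hns (g4.2 _ hP h4)⟩

/-! ## §9 (v1.4, F11) the CHARGED-PAIR FRAGMENT of rule D suffices for the BULK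
Machine fact (engine `rd.c`, `RD_KEEPMASK=1111`; exact at FULL ◇₄ ∕ ◇₆ ∕ ◇₈ ∕ ◇₁₀): keeping ONLY the rule-D instances `(g, j, k, k′)` whose two factor points
`Z g`, `Z j` are both CHARGED (no apex point in the constrained pair), the plain-UP closure of «multi-line 2+2 absent» still refutes every multi-line
3-∕4-charged cell — 980∕980, 12 880∕12 880, 87 012∕87 012, 402 802∕402 802, conflict 0 — with the SAME maximal depth 4 · 6 · 9 · 12 (clauses ◇₁₀: 6 062 898 of
8 399 756; the apex instances are the long clauses). So the induction for `BulkStepN∕P` never needs a rule-D instance at an apex letter: the hypothesis below is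
WEAKER than `RuleDMu4Closed` and the statement `BulkRDCharged h` is STRONGER than `BulkRD h` (proved for NO `h`). -/

/-- rule D at an `N`-cell, restricted to pairs of CHARGED factor points (`Pad4TowerRuleDMu4.RuleDMu4N` with the two extra hypotheses `(Z g).2 ≠ (0,0)`,
`(Z j).2 ≠ (0,0)`). -/
def RuleDChargedN (C : MConfig) (Z : MCell) : Prop :=
  ∀ g j : Fin 4, g ≠ j → (Z g).2 ≠ (0, 0) → (Z j).2 ≠ (0, 0) → ∀ k k' : Fin 4, Adapted (Z g) k → Adapted (Z j) k' →
    coord (Z g) k ≠ coord (Z j) k' → SettledBelow C Z g k ∨ SettledBelow C Z j k' ∨ CoveredBelow C Z g k j k'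

/-- the same at a `P`-cell (service and covers ABOVE). -/
def RuleDChargedP (C : MConfig) (P : MCell) : Prop :=
  ∀ g j : Fin 4, g ≠ j → (P g).2 ≠ (0, 0) → (P j).2 ≠ (0, 0) → ∀ k k' : Fin 4, Adapted (P g) k → Adapted (P j) k' →
    coord (P g) k ≠ coord (P j) k' → SettledAbove C P g k ∨ SettledAbove C P j k' ∨ CoveredAbove C P g k j k'

/-- closure under the charged-pair fragment of rule D. -/
def RuleDChargedClosed (C : MConfig) : Prop := (∀ Z ∈ C.lower, RuleDChargedN C Z) ∧ (∀ P ∈ C.upper, RuleDChargedP C P)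

theorem ruleDChargedClosed_of_ruleDMu4Closed {C : MConfig} (h : RuleDMu4Closed C) : RuleDChargedClosed C :=
  ⟨fun Z hZ g j hgj _ _ k k' hk hk' hne => h.1 Z hZ g j hgj k k' hk hk' hne,
   fun P hP g j hgj _ _ k k' hk hk' hne => h.2 P hP g j hgj k k' hk hk' hne⟩

/-- **BULK from the CHARGED-PAIR fragment** (F11; proved for NO `h`; machine-exact at FULL ◇₄∕◇₆∕◇₈∕◇₁₀): a `◇_h`-supported `G₁`-closed support closed under
the charged-pair instances of rule D whose multi-line 2+2 cells are absent has all its 3- and 4-charged cells single-line. -/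
def BulkRDCharged (h : ℤ) : Prop :=
  ∀ C : MConfig, C.InDiamond h → C.G1Closed → RuleDChargedClosed C → GradeConfined 2 C → GradeConfined 3 C ∧ GradeConfined 4 C

theorem bulkRD_of_bulkRDCharged {h : ℤ} (H : BulkRDCharged h) : BulkRD h :=
  fun C hD hG hR g2 => H C hD hG (ruleDChargedClosed_of_ruleDMu4Closed hR) g2

/-! ### §9b (v1.4) MONOTONICITY in `h` — the targets are ANTITONE: a larger diamond is a stronger statement
(F12, for provers: every cell of ◇_h is a cell of ◇_{h+2}; a ◇_h-supported configuration is ◇_{h+2}-supported and rule-D closure does not mention `h`, so `BulkRD (h+2) → BulkRD h`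
trivially — the all-h statement is the h → ∞ limit and (F1) at ◇₁₀ contains (F1) at ◇₄∕◇₆∕◇₈. The measured UP depth of a FIXED cell grows with the ambient h (◇₄-cells: max 4 in ◇₄, 6 in ◇₆;
◇₆-cells: 6 → 9 in ◇₈; 0 cells get shallower) only because the larger run does not assume the cells outside ◇_h dead: DP clauses of a fixed upper owner acquire servers ABOVE, DN clauses of a
fixed lower owner are identical. So an induction ON h by restriction is available for free in one direction and says nothing in the other; the content is uniform in h.) -/

theorem inDiamond_mono' {h h' : ℤ} (hh : h ≤ h') {x : BPoint} (hx : InDiamond h x) : InDiamond h' x :=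
  ⟨hx.1, hx.2.1, hx.2.2.1, le_trans hx.2.2.2 hh⟩

theorem configInDiamond_mono {h h' : ℤ} (hh : h ≤ h') {C : MConfig} (hC : C.InDiamond h) : C.InDiamond h' :=
  ⟨fun Z hZ f => inDiamond_mono' hh (hC.1 Z hZ f), fun P hP f => inDiamond_mono' hh (hC.2 P hP f)⟩

theorem bulkRD_antitone {h h' : ℤ} (hh : h ≤ h') (H : BulkRD h') : BulkRD h :=
  fun C hD hG hR g2 => H C (configInDiamond_mono hh hD) hG hR g2

theorem bulkRDCharged_antitone {h h' : ℤ} (hh : h ≤ h') (H : BulkRDCharged h') : BulkRDCharged h :=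
  fun C hD hG hR g2 => H C (configInDiamond_mono hh hD) hG hR g2

theorem lineConfinement_antitone {h h' : ℤ} (hh : h ≤ h') (H : LineConfinement h') : LineConfinement h :=
  fun C hD hG hS => H C (configInDiamond_mono hh hD) hG hS

end ChargeLadderSketch
end AnomalyLens
end Summit.Ventures.HSemireg.Pad4Tower
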